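import Summits.CriticalPhenomena.CardyFormulaZ2.Theorems.CardyFlipRussoVoronoiHubFromSmirnovOneArmDefs

/-!
# Potential-defect events of the one-arm route — fourth definitions module of line
# `moebius-exact-delaunay-dilation-ward` (crux `VoronoiHubFromSmirnov`, stmt-CriticalPhenomena-6433)

Two LOCAL events of a set of nuclei `N ⊆ ℂ` near a centre `z` (configuration coordinates), the
two alternatives of Benjamini–Schramm's potential defects (CMP 197 (1998) §4, Lemma 4.2; landed as
`defect_implies_potentialDefect`): a NEAR-TIED NAVEL — four distinct nuclei `p, q, a, b` and a point
`x` within `ρ` of `z` with `|px| = |qx| ≤ ℓ`, `|ax| = |bx| ∈ [|px|, |px| + τ)` — and a CLOSE PAIR — two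
distinct nuclei within `τ`, one of them within `ρ` of `z`.  They are literally the events whose
Poisson probabilities the landed `poisson_navelTie_le` / `poisson_closePair_le` bound (there with
`z = 0`), so that the defective-square probability of the one-arm route (third definitions module,
`DefSq`) is controlled square by square: a defect pair in an `ℓ`-square forces, on the no-void event,
`NearTie` or `ClosePair` near the square for the nuclei OR for their pulled-back images (lead c3
bricks Pr1a/Pr1b).

Also named here: the image-side core statement `Sig.unitW` (homogeneous law, window `V/δ`,
Euclidean vs pulled-back chain crossings), from which brick L1 recovers `Sig.stub_graphTransport`.
Only Props, monotonicity, and the registered glue identity `adjCross_adjHyb_univ_iff` (all squares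
switched = the pulled-back event) are declared.
-/

noncomputable section

namespace Summit.CriticalPhenomena.CardyFormulaZ2.Cruxes.VoronoiHubFromSmirnov.MoebiusExactDelaunayDilationWard

open Set Metric

/-- **Near-tied navel** near `z` (Benjamini–Schramm potential defect, first kind; the event of the
landed `poisson_navelTie_le` re-centred at `z`): distinct nuclei `p, q, a, b ∈ N` and a point `x`
with `dist x z ≤ ρ`, `dist p x = dist q x ≤ ℓ`, `dist a x = dist b x`, and
`dist p x ≤ dist a x < dist p x + τ`. -/
def NearTie (N : Set ℂ) (z : ℂ) (ρ ℓ τ : ℝ) : Prop :=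
  ∃ x p q a b : ℂ, p ∈ N ∧ q ∈ N ∧ a ∈ N ∧ b ∈ N ∧ p ≠ q ∧ a ≠ b ∧ a ≠ p ∧ a ≠ q ∧ b ≠ p ∧
    b ≠ q ∧ x ∈ closedBall z ρ ∧ dist p x = dist q x ∧ dist p x ≤ ℓ ∧ dist a x = dist b x ∧
    dist p x ≤ dist a x ∧ dist a x < dist p x + τ

/-- **Close pair** near `z` (Benjamini–Schramm potential defect, second kind; the event of the landed
`poisson_closePair_le` re-centred at `z`): distinct nuclei `a, b ∈ N` with `dist a z ≤ ρ` and
`dist a b < τ`. -/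
def ClosePair (N : Set ℂ) (z : ℂ) (ρ τ : ℝ) : Prop :=
  ∃ a ∈ N, ∃ b ∈ N, a ≠ b ∧ a ∈ closedBall z ρ ∧ dist a b < τ

/-- `NearTie` is monotone in the nuclei, the radius, and the tolerance, and re-centres. -/
theorem NearTie.mono {N N' : Set ℂ} {z z' : ℂ} {ρ ρ' ℓ ℓ' τ τ' : ℝ} (h : NearTie N z ρ ℓ τ)
    (hN : N ⊆ N') (hρ : ρ + dist z z' ≤ ρ') (hℓ : ℓ ≤ ℓ') (hτ : τ ≤ τ') : NearTie N' z' ρ' ℓ' τ' := by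
  obtain ⟨x, p, q, a, b, hp, hq, ha, hb, h1, h2, h3, h4, h5, h6, hx, h7, h8, h9, h10, h11⟩ := h
  refine ⟨x, p, q, a, b, hN hp, hN hq, hN ha, hN hb, h1, h2, h3, h4, h5, h6, ?_, h7, h8.trans hℓ, h9,
    h10, h11.trans_le (by linarith)⟩
  rw [mem_closedBall] at hx ⊢
  linarith [dist_triangle x z z']

/-- `ClosePair` is monotone in the nuclei, the radius, and the tolerance, and re-centres. -/
theorem ClosePair.mono {N N' : Set ℂ} {z z' : ℂ} {ρ ρ' τ τ' : ℝ} (h : ClosePair N z ρ τ)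
    (hN : N ⊆ N') (hρ : ρ + dist z z' ≤ ρ') (hτ : τ ≤ τ') : ClosePair N' z' ρ' τ' := by
  obtain ⟨a, ha, b, hb, hab, haz, hd⟩ := h
  refine ⟨a, hN ha, b, hN hb, hab, ?_, hd.trans_le hτ⟩
  rw [mem_closedBall] at haz ⊢
  linarith [dist_triangle a z z']

/-- **The image-side core (`UnitW`)** of the one-arm route: for the HOMOGENEOUS two-colour law
`lawBW volume` on the whole plane, a univalent `g` on an open `U ⊇ closure V` (`V` open bounded,
`closure Ω' ⊆ V`), and admissible carrier / attachment families of the conformal rectangle `R'`, the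
probability that the nuclei of the window `V/δ` contain a Euclidean Delaunay chain crossing and the
probability of the chain crossing for the adjacency pulled back through `g` differ by `o(1)` as
`δ → 0⁺`.  The registered S3b-i core is this statement (from Tassion's one-arm decay) transported
back to the domain side (`Sig.stub_graphTransport` follows by the law identity of the landed
`graphLaw_core` pattern and no-void locality; lead c3 brick L1). -/
def Sig.unitW : Prop :=
  ∀ (R' : Literature.Probability.RandomPlanarGeometry.ConformalRectangle) (g : ℂ → ℂ) (U : Set ℂ),
    IsOpen U → closure R'.carrier ⊆ U → DifferentiableOn ℂ g U → Set.InjOn g U →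
    ∀ V : Set ℂ, IsOpen V → Bornology.IsBounded V → closure R'.carrier ⊆ V → closure V ⊆ U →
    ∀ (K A₀ A₂ : ℝ → Set ℂ), IsDomainFamily R' K → IsAttachment R' 0 A₀ → IsAttachment R' 2 A₂ →
      Filter.Tendsto (fun δ : ℝ =>
        (lawBW (MeasureTheory.volume : MeasureTheory.Measure ℂ)).real
            {c | (Literature.Analysis.FunctionSpaces.PointConfig.restrict {b : ℂ | (δ : ℂ) * b ∈ V} c.1,
              Literature.Analysis.FunctionSpaces.PointConfig.restrict {b : ℂ | (δ : ℂ) * b ∈ V} c.2) ∈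
              graphCross (K δ) (A₀ δ) (A₂ δ) δ}
          - (lawBW (MeasureTheory.volume : MeasureTheory.Measure ℂ)).real
              (hGraphCross (K δ) (A₀ δ) (A₂ δ) g V δ))
        (nhdsWithin 0 (Set.Ioi 0)) (nhds 0)

/-- Registered glue sub-goal of this module: with EVERY square switched the hybrid chain crossing is
the pulled-back one (`E₂` on all pairs). -/
theorem adjCross_adjHyb_univ_iff : ∀ (ℓ : ℝ) (E₁ E₂ : ℂ → ℂ → Prop) (K A₀ A₂ : Set ℂ) (δ : ℝ)
    (b : Set ℂ), adjCross (adjHyb Set.univ ℓ E₁ E₂) K A₀ A₂ δ b ↔ adjCross E₂ K A₀ A₂ δ b := by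
  intro ℓ E₁ E₂ K A₀ A₂ δ b
  have h : ∀ p q, adjHyb Set.univ ℓ E₁ E₂ p q ↔ E₂ p q := fun p q =>
    adjHyb_of_mem E₁ E₂ (Or.inl (mem_univ _))
  constructor <;> intro hc
  · exact adjCross_mono (fun p q hpq => (h p q).1 hpq) hc
  · exact adjCross_mono (fun p q hpq => (h p q).2 hpq) hc

end Summit.CriticalPhenomena.CardyFormulaZ2.Cruxes.VoronoiHubFromSmirnov.MoebiusExactDelaunayDilationWard

end
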